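import Summits.AnomalousDissipation.AnomalousDissipation.Theses.SteadyWeakLimit
import Literature.Analysis.FunctionSpaces.TorusCalculusProofs

/-!
Birth skeleton for piece B = `SubviscousDefectAbsorption`
(stmt-AnomalousDissipation-18057): line `limit-set-closure`.

stub_weakCompactness — weak sequential compactness of `L²`-bounded sequences of smooth fields on `T³`,
  tested against smooth fields (Banach–Alaoglu + separability; KNOWN, M/L in Lean).
stub_limitSetClosure — the LIMIT-SET form of B (its open PDE content): if `v` is the weak limit of a
  bounded steady family with sub-viscous force defect from `f`, then `v` is also the weak limit of a
  bounded family of steady classical states of the EXACT force `f` (some viscosities `ν' j → 0+`).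
B_of — compactness + closure ⇒ B (extract `u (φ j) ⇀ v`, realise `v` exactly, subtract).
-/

namespace Summit.AnomalousDissipation.AnomalousDissipation.Cruxes.SteadyWeakRealisation.LimitSetClosure

open MeasureTheory Filter Topology
open scoped InnerProductSpace ENNReal
open Literature.Analysis.FunctionSpaces Literature.Analysis.FunctionSpaces.Torus
open Summit.AnomalousDissipation.AnomalousDissipation.Theses.SteadyWeakLimit

/-- STUB 1 (known, M/L): weak sequential compactness in `L²(T³; ℝ³)` of bounded sequences of smooth
fields, tested against smooth fields (Banach–Alaoglu on the separable Hilbert space `L²` + density of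
smooth fields; Brezis Thm 3.18 / Cor. 3.30). -/
theorem stub_weakCompactness :
    ∀ (g : ℕ → UnitAddTorus (Fin 3) → EuclideanSpace ℝ (Fin 3)) (E : ℝ), (∀ j, IsSmooth (g j)) →
      (∀ j, ∫ x, ‖g j x‖ ^ 2 ≤ E) →
      ∃ (φ : ℕ → ℕ) (v : UnitAddTorus (Fin 3) → EuclideanSpace ℝ (Fin 3)), StrictMono φ ∧
        MemLp v 2 volume ∧
        ∀ w : UnitAddTorus (Fin 3) → EuclideanSpace ℝ (Fin 3), IsSmooth w →
          Tendsto (fun j => ∫ x, ⟪w x, g (φ j) x⟫_ℝ) atTop (𝓝 (∫ x, ⟪w x, v x⟫_ℝ)) := by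
  sorry

/-- STUB 2 (the open heart, XL): LIMIT-SET CLOSURE under sub-viscous force defects — a weak `L²` limit
`v` of a bounded steady classical family with `‖fs j - f‖_{L²} ≤ δ j · ν j`, `δ j → 0`, `ν j → 0+`, is
also the weak limit of a bounded family of steady classical states of the EXACT force `f`. -/
theorem stub_limitSetClosure :
    ∀ (f v : UnitAddTorus (Fin 3) → EuclideanSpace ℝ (Fin 3)) (ν δ : ℕ → ℝ)
      (fs u : ℕ → UnitAddTorus (Fin 3) → EuclideanSpace ℝ (Fin 3)) (p : ℕ → UnitAddTorus (Fin 3) → ℝ)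
      (E : ℝ), IsSmooth f → IsDivFree f → HasZeroMean f → (∀ j, 0 < ν j) → Tendsto ν atTop (𝓝 0) →
      (∀ j, IsSmooth (fs j) ∧ IsDivFree (fs j) ∧ HasZeroMean (fs j)) → Tendsto δ atTop (𝓝 0) →
      (∀ j, eLpNorm (fs j - f) 2 volume ≤ ENNReal.ofReal (δ j * ν j)) →
      (∀ j, IsClassicalNSSolutionOn Set.univ (ν j) (fun _ => fs j) (fun _ => u j) (fun _ => p j)) →
      (∀ j, ∫ x, ‖u j x‖ ^ 2 ≤ E) → MemLp v 2 volume →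
      (∀ w : UnitAddTorus (Fin 3) → EuclideanSpace ℝ (Fin 3), IsSmooth w →
        Tendsto (fun j => ∫ x, ⟪w x, u j x⟫_ℝ) atTop (𝓝 (∫ x, ⟪w x, v x⟫_ℝ))) →
      ∃ (ν' : ℕ → ℝ) (u' : ℕ → UnitAddTorus (Fin 3) → EuclideanSpace ℝ (Fin 3))
        (p' : ℕ → UnitAddTorus (Fin 3) → ℝ) (E' : ℝ), (∀ j, 0 < ν' j) ∧ Tendsto ν' atTop (𝓝 0) ∧
        (∀ j, IsClassicalNSSolutionOn Set.univ (ν' j) (fun _ => f) (fun _ => u' j) (fun _ => p' j)) ∧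
        (∀ j, ∫ x, ‖u' j x‖ ^ 2 ≤ E') ∧
        ∀ w : UnitAddTorus (Fin 3) → EuclideanSpace ℝ (Fin 3), IsSmooth w →
          Tendsto (fun j => ∫ x, ⟪w x, u' j x⟫_ℝ) atTop (𝓝 (∫ x, ⟪w x, v x⟫_ℝ)) := by
  sorry

/-- COMPOSITION (kernel-checked, no sorry of its own; uses the two stubs by name): compactness +
limit-set closure ⇒ B. Extract a weakly convergent subsequence `u (φ j) ⇀ v` (stub 1; the states are
smooth classical slices), pass the sub-viscous hypotheses to the subsequence, realise `v` by an
exact-force family (stub 2) and subtract: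
`∫ ⟪w, u' j - u (φ j)⟫ = ∫ ⟪w, u' j⟫ - ∫ ⟪w, u (φ j)⟫ → ∫ ⟪w, v⟫ - ∫ ⟪w, v⟫ = 0`. -/
theorem SubviscousDefectAbsorption_of :
    Summit.AnomalousDissipation.AnomalousDissipation.Theses.SteadyWeakLimit.SubviscousDefectAbsorption := by
  unfold SubviscousDefectAbsorption
  intro f ν δ fs u p E hf hdf hmf hν hν0 hfs hδ hdef hNS hE
  -- the states are smooth (time slices of jointly smooth space–time fields)
  have hu : ∀ j, IsSmooth (u j) := fun j =>
    (hNS j).smooth_velocity.isSmooth_slice (Set.mem_univ (0 : ℝ))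
  -- weak compactness: `u (φ j) ⇀ v`
  obtain ⟨φ, v, hφ, hv, hweak⟩ := stub_weakCompactness u E hu hE
  -- the subsequence is again a sub-viscous family (same `f`, data reindexed by `φ`)
  have hφt : Tendsto φ atTop atTop := hφ.tendsto_atTop
  obtain ⟨ν', u', p', E', hν', hν'0, hNS', hE', hweak'⟩ :=
    stub_limitSetClosure f v (ν ∘ φ) (δ ∘ φ) (fs ∘ φ) (u ∘ φ) (p ∘ φ) E hf hdf hmf (fun j => hν (φ j))
      (hν0.comp hφt) (fun j => hfs (φ j)) (hδ.comp hφt) (fun j => hdef (φ j)) (fun j => hNS (φ j))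
      (fun j => hE (φ j)) hv hweak
  have hu' : ∀ j, IsSmooth (u' j) := fun j =>
    (hNS' j).smooth_velocity.isSmooth_slice (Set.mem_univ (0 : ℝ))
  refine ⟨φ, ν', u', p', E', hφ, hν', hν'0, hNS', hE', fun w hw => ?_⟩
  -- subtract the two weak limits
  have hsplit : ∀ j, ∫ x, ⟪w x, u' j x - u (φ j) x⟫_ℝ =
      (∫ x, ⟪w x, u' j x⟫_ℝ) - ∫ x, ⟪w x, u (φ j) x⟫_ℝ := by
    intro j
    rw [← integral_sub (hw.inner (hu' j)).integrable (hw.inner (hu (φ j))).integrable]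
    refine integral_congr_ae (ae_of_all _ fun x => ?_)
    exact inner_sub_right _ _ _
  have h3 := (hweak' w hw).sub (hweak w hw)
  rw [sub_self] at h3
  exact h3.congr fun j => (hsplit j).symm

end Summit.AnomalousDissipation.AnomalousDissipation.Cruxes.SteadyWeakRealisation.LimitSetClosure
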